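import Summits.AtomisticToContinuum.Crystallization.Theorems.PalmUnimodularRigidityLayeredLawsSelectHcpCertificateDefsB
import Mathlib.Probability.Kernel.Basic

/-!
# Route `PalmUnimodularRigidity`, crux `LayeredLawsSelectHcp` (stmt-AtomisticToContinuum-9226):
# certificate vocabulary, part C — the measurable surrogate of a chart sum (iterated Campbell integrals)

Addendum to `…CertificateDefs(B).lean` (lead c2, cycle 3).  The Mecke transport function of a near-admissible corrector datum,
`g(μ, y) = coef · Σ_{Ψ ∈ rootedCharts (θ_y μ), Ψ ê = −y} φ Ψ` (charts rooted at the receiving atom, reading only the near ball), is made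
JOINTLY MEASURABLE in `(μ, y)` by writing the chart sum as an ITERATED INTEGRAL over the near-ball labels against an s-finite kernel
`κ` that agrees with the identity on locally finite measures (`Literature.Probability.Process.exists_isSFiniteKernel_apply_eq_self`):
`iterInt κ L H μ z = ∫ x, iterInt κ L' H μ (update z u x) ∂(κ μ)` along the label list `L = u :: L'`, with the integrand
`chartWeight e ψ y z = ψ (z|nearBall)` if `z` is a local chart pattern (`z 0 = 0`, injective on the near ball, ideal unit struts ↔ bonds
on the near ball) with `z e = −y`, and `0` otherwise.  On a rooted hcp-charted tube configuration the iterated integral against `count|S`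
is the finite sum over the local charts, i.e. over the twelve rooted charts (registered sub-goals `tube_localChart_iff`,
`tube_iterInt_count_eq_chartSum`), and `(μ, y) ↦ iterInt κ L (chartWeight e ψ y) (θ_y μ) 0` is measurable (`tube_measurable_iterInt`).
Definitions with parameters only; `[folklore]`; anchor `iterInt_nil` registered. -/

noncomputable section

namespace Summit.AtomisticToContinuum.Crystallization.Theorems.PalmUnimodularRigidity.LayeredLawsSelectHcp

open MeasureTheory Set ProbabilityTheory
open Literature.MathematicalPhysics.StatisticalMechanics Literature.Geometry.DiscreteGeometry

/-- **Local chart pattern** (configuration-free part of `IsLocalChart`): root at `0`, injective on the near ball, ideal unit struts ↔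
bonds on the near ball.  (`IsLocalChart S z ↔ IsLocalChartPattern z ∧ ∀ u ∈ nearBall, z u ∈ S`.) [folklore] -/
def IsLocalChartPattern (z : ℤ × ℤ × ℤ → EuclideanSpace ℝ (Fin 3)) : Prop :=
  z 0 = 0 ∧ Set.InjOn z ↑nearBall ∧
    ∀ u ∈ nearBall, ∀ w ∈ nearBall,
      dist (hcpSite 1 (Real.sqrt (2 / 3)) u) (hcpSite 1 (Real.sqrt (2 / 3)) w) = 1 ↔
        (0 < dist (z u) (z w) ∧ dist (z u) (z w) ≤ 28 / 25)

open Classical in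
/-- **Chart weight**: the integrand of the measurable surrogate — `ψ` read on the near ball if `z` is a local chart pattern whose label
`e` sits at `−y`, else `0`. [folklore] -/
def chartWeight (e : ℤ × ℤ × ℤ) (ψ : (↥nearBall → EuclideanSpace ℝ (Fin 3)) → ℝ) (y : EuclideanSpace ℝ (Fin 3))
    (z : ℤ × ℤ × ℤ → EuclideanSpace ℝ (Fin 3)) : ℝ :=
  if IsLocalChartPattern z ∧ z e = -y then ψ (fun u => z u) else 0

/-- **Iterated integral along a label list** against the kernel `κ`: `iterInt κ [] H μ z = H z` and
`iterInt κ (u :: L) H μ z = ∫ x, iterInt κ L H μ (Function.update z u x) ∂(κ μ)`. [folklore] -/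
def iterInt (κ : Kernel (Measure (EuclideanSpace ℝ (Fin 3))) (EuclideanSpace ℝ (Fin 3))) :
    List (ℤ × ℤ × ℤ) → ((ℤ × ℤ × ℤ → EuclideanSpace ℝ (Fin 3)) → ℝ) → Measure (EuclideanSpace ℝ (Fin 3)) →
      (ℤ × ℤ × ℤ → EuclideanSpace ℝ (Fin 3)) → ℝ
  | [], H, _, z => H z
  | u :: L, H, μ, z => ∫ x, iterInt κ L H μ (Function.update z u x) ∂(κ μ)

/-- Anchor (registered sub-goal `iterInt_nil`): the empty iterated integral is evaluation. [folklore] -/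
theorem iterInt_nil : ∀ (κ : Kernel (Measure (EuclideanSpace ℝ (Fin 3))) (EuclideanSpace ℝ (Fin 3)))
    (H : (ℤ × ℤ × ℤ → EuclideanSpace ℝ (Fin 3)) → ℝ) (μ : Measure (EuclideanSpace ℝ (Fin 3)))
    (z : ℤ × ℤ × ℤ → EuclideanSpace ℝ (Fin 3)), iterInt κ [] H μ z = H z := by
  intro κ H μ z
  rfl

/-- The cons step of the iterated integral. [folklore] -/
theorem iterInt_cons (κ : Kernel (Measure (EuclideanSpace ℝ (Fin 3))) (EuclideanSpace ℝ (Fin 3))) (u : ℤ × ℤ × ℤ)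
    (L : List (ℤ × ℤ × ℤ)) (H : (ℤ × ℤ × ℤ → EuclideanSpace ℝ (Fin 3)) → ℝ) (μ : Measure (EuclideanSpace ℝ (Fin 3)))
    (z : ℤ × ℤ × ℤ → EuclideanSpace ℝ (Fin 3)) :
    iterInt κ (u :: L) H μ z = ∫ x, iterInt κ L H μ (Function.update z u x) ∂(κ μ) := by
  rfl

/-- A local chart is a local chart pattern with near-ball values in `S`. [folklore] -/
theorem isLocalChart_iff_pattern (S : Set (EuclideanSpace ℝ (Fin 3))) (z : ℤ × ℤ × ℤ → EuclideanSpace ℝ (Fin 3)) :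
    IsLocalChart S z ↔ IsLocalChartPattern z ∧ ∀ u ∈ nearBall, z u ∈ S := by
  unfold IsLocalChart IsLocalChartPattern
  tauto

end Summit.AtomisticToContinuum.Crystallization.Theorems.PalmUnimodularRigidity.LayeredLawsSelectHcp

end
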